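import Literature.NumberTheory.NumberFields.BauerSplitPrimes
import Literature.NumberTheory.GaloisRepresentations.FrobeniusDensityTheorem
import Literature.NumberTheory.GaloisRepresentations.ArtinLemma
import Mathlib.FieldTheory.PrimitiveElement
import HarnessLib

/-!
# Extensions in which prescribed primes split completely are linearly disjoint from a given
# field, and leave the image of a Galois representation unchanged

Topic `NumberTheory/NumberFields` (finite Galois theory of number fields; vocabulary of the tree's
`FrobeniusDensityTheorem.lean`: `splitPrimes M E` = the primes of `M` that split completely in
`E`, Mathlib `IsArithFrobAt`, `IntermediateField.fixingSubgroup`).  Theorem-only file (no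
definition, no named fact, D-0026), unconditional (the analytic input is Bauer's / Chebotarev's
existence theorem `infinite_setOf_exists_isArithFrobAt` of `BauerSplitPrimes.lean`).

This is the device by which the potential-automorphy literature keeps the image of a residual
representation unchanged under the auxiliary base changes `E/F` (Clozel–Harris–Taylor 2008,
§4.2–4.3; Barnet-Lamb–Gee–Geraghty–Taylor 2014, §4; Calegari–Geraghty; and — the occurrence
formalised here — Allen–Calegari–Caraiani–Gee–Helm–Le Hung–Newton–Scholze–Taylor–Thorne,
*Potential automorphy over CM fields*, Ann. of Math. 197 (2023), proof of Thm. 6.1.1, §6.5.12,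
arXiv:1812.09999 p. 88):

> Let `K/F(ζ_p)` be the extension cut out by `ρ̄|_{G_{F(ζ_p)}}`. Choose finite sets `V₀, V₁, V₂`
> of finite places of `F` having the following properties: for each `v ∈ V₀`, `v` splits in
> `F(ζ_p)`; for each proper subfield `K/K'/F(ζ_p)`, there exists `v ∈ V₀` such that `v` splits in
> `F(ζ_p)` but does not split in `K'`.  For each proper subfield `K/K'/F`, there exists `v ∈ V₁`
> which does not split in `K'`. […] If `E/F` is any finite Galois extension which is
> `V₀ ∪ V₁ ∪ V₂`-split, then `ρ̄(G_E) = ρ̄(G_F)` and `ρ̄(G_{E(ζ_p)}) = ρ̄(G_{F(ζ_p)})`.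

Everything is proved at FINITE level, inside an ambient finite Galois extension `L/M` of number
fields containing all the fields in play (in the application: a Galois closure of `E · K(ζ_p)`),
with `E`, `K`, `F₁ = M(ζ_p)` intermediate fields of `L/M` and `ρ̄` replaced by any homomorphism
`τ : Gal(L/M) → H`:

* §1 `mem_splitPrimes_intermediateField_iff_forall` — **Frobenius criterion for complete
  splitting in an arbitrary (not necessarily Galois) subextension `E`**: a prime `q` of `M`
  unramified in `L` splits completely in `E` iff EVERY arithmetic Frobenius of `L/M` at EVERY
  prime of `L` above `q` fixes `E` (Marcus, *Number Fields*, Ch. 4, Thm. 29 and Exercise 11: the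
  decomposition field; the tree's `mem_splitPrimes_intermediateField_iff` is the Galois case,
  where one Frobenius suffices).  Corollaries: complete splitting descends to subfields
  (`splitPrimes_anti`), ascends to composita (`mem_splitPrimes_sup`), and is obstructed by one
  Frobenius not fixing `E` (`not_mem_splitPrimes_of_not_mem_fixingSubgroup`).
* §2 `inf_eq_bot_of_splitPrimes`, `sup_inf_eq_of_splitPrimes` — **disjointness**: if a set `V`
  of primes detects every non-trivial subfield `K' ≠ M` of `K` (some `q ∈ V` does not split
  completely in `K'`) and every `q ∈ V` splits completely in `E`, then `E ∩ K = M`; relative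
  version over a subfield `F₁ ≤ K₁`: `E F₁ ∩ K₁ = F₁`.
* §3 `exists_finset_forall_not_mem_splitPrimes`, `exists_finset_forall_not_mem_splitPrimes_of_le`
  — **existence of `V₁` and `V₀`** avoiding any finite set `S`, consisting of degree-one primes
  unramified in `L` (Bauer/Chebotarev: a Frobenius outside `Gal(L/K')`, resp. in
  `Gal(L/F₁) ∖ Gal(L/K')`, at a degree-one prime; finitely many `K'` by the primitive element
  theorem, Mathlib `Field.finite_intermediateField_of_exists_primitive_element`).
* §4 `map_fixingSubgroup_eq_range_of_inf_eq_bot`, `map_fixingSubgroup_inf_eq_of_sup_inf_eq` —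
  **images**: `E ∩ L^{ker τ} = M ⟹ τ(Gal(L/E)) = τ(Gal(L/M))`, and
  `E F₁ ∩ L^{ker τ ∩ Gal(L/F₁)} = F₁ ⟹ τ(Gal(L/E F₁)) = τ(Gal(L/F₁))` (Galois correspondence).
* §5 `exists_finset_map_fixingSubgroup_eq_of_splitPrimes` — **the printed statement**: there is
  a finite set `V` of degree-one primes of `M`, unramified in `L` and outside `S`, such that for
  every subextension `E` of `L/M` in which all `q ∈ V` split completely,
  `τ(Gal(L/E)) = τ(Gal(L/M))` and `τ(Gal(L/E) ∩ Gal(L/F₁)) = τ(Gal(L/F₁))`.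

These serve the named fact
`Literature.NumberTheory.Automorphic.ACCGHLNSTT2023.automorphyLifting_crystalline_weightZero`
(`Automorphic/ACCAutomorphyLiftingCrystalline.lean`).

## References

* [ACCGHLNSTT2023] P. B. Allen et al., *Potential automorphy over CM fields*, Ann. of Math. (2)
  197 (2023), 897–1113, §6.5.12 (proof of Thm. 6.1.1), choice of `V₀, V₁, V₂`
  (arXiv:1812.09999, p. 88).
* [Marcus2018] D. A. Marcus, *Number Fields*, 2nd ed. (2018), Ch. 4, Thm. 29 (decomposition
  field: "`P` splits completely in `L_D`") and Exercises 10–11.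
* [NeukirchANT1999] J. Neukirch, *Algebraic Number Theory* (1999), Ch. VII (13.4), (13.9) (Bauer).
* [CHT2008] L. Clozel, M. Harris, R. Taylor, *Automorphy for some `l`-adic lifts of automorphic
  mod `l` Galois representations*, Publ. Math. IHÉS 108 (2008), §4.2.
-/

noncomputable section

open NumberField IsDedekindDomain

open scoped Classical

namespace Literature.NumberTheory.NumberFields

open Literature.NumberTheory.GaloisRepresentations

variable {M L : Type} [Field M] [NumberField M] [Field L] [NumberField L] [Algebra M L]
  [IsGalois M L]

/-! ### §1. Frobenius criterion for complete splitting in an arbitrary subextension -/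

/-- **Frobenius criterion for complete splitting in a subextension** (Marcus, *Number Fields*,
Ch. 4, Thm. 29 and Exercise 11: a prime splits completely in `E` iff `E` lies in the
decomposition field of every prime above it).  Let `L/M` be finite Galois, `E` an intermediate
field (not necessarily Galois over `M`) and `q` a prime of `M` unramified in `L`.  Then `q` splits
completely in `E` iff every arithmetic Frobenius `φ ∈ Gal(L/M)` at every prime `Q ∣ q` of `L`
fixes `E` pointwise.  (`→`: the tree's `mem_fixingSubgroup_of_inertiaDeg_under_eq_one`; `←`: every
prime of `E` above `q` is `Q ∩ E` for some `Q`, which carries a Frobenius, and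
`inertiaDeg_under_eq_one_of_mem_fixingSubgroup`; unramifiedness descends to `E`,
`ArtinLemma.isUnramifiedIn_intermediateField`.) [cite: Marcus2018, Ch. 4, Thm. 29] -/
theorem mem_splitPrimes_intermediateField_iff_forall (E : IntermediateField M L)
    {q : HeightOneSpectrum (𝓞 M)} (hunr : Algebra.IsUnramifiedIn (𝓞 L) q.asIdeal) :
    q ∈ splitPrimes M E ↔ ∀ Q ∈ q.asIdeal.primesOver (𝓞 L), ∀ φ : L ≃ₐ[M] L,
      IsArithFrobAt (𝓞 M) φ Q → φ ∈ E.fixingSubgroup := by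
  haveI : NumberField E := NumberField.of_module_finite M E
  constructor
  · intro h Q hQ φ hφ
    exact mem_fixingSubgroup_of_inertiaDeg_under_eq_one E hunr hQ hφ
      (h.2 _ (under_intermediateField_mem_primesOver E hQ))
  · intro h
    refine ⟨ArtinLemma.isUnramifiedIn_intermediateField E hunr, fun P hP => ?_⟩
    haveI := hP.1
    haveI := hP.2
    have hPne : P ≠ ⊥ := Ideal.ne_bot_of_liesOver_of_ne_bot q.ne_bot P
    haveI : P.IsMaximal := hP.1.isMaximal hPne
    obtain ⟨Q, hQmax, hQover⟩ :=
      Ideal.exists_maximal_ideal_liesOver_of_isIntegral (S := 𝓞 L) P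
    haveI := hQmax.isPrime
    haveI := hQover
    haveI : Q.LiesOver q.asIdeal := Ideal.LiesOver.trans Q P q.asIdeal
    have hQ : Q ∈ q.asIdeal.primesOver (𝓞 L) := ⟨hQmax.isPrime, inferInstance⟩
    have hQne : Q ≠ ⊥ := Ideal.ne_bot_of_mem_primesOver q.ne_bot hQ
    obtain ⟨φ, hφ⟩ := exists_isArithFrobAt_ringOfIntegers (M := M) Q hQne
    have h1 := inertiaDeg_under_eq_one_of_mem_fixingSubgroup E hQ hφ (h Q hQ φ hφ)
    rwa [← hQover.over] at h1

/-- **Complete splitting descends to subfields**: if `q` (unramified in `L`) splits completely in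
`E` then it splits completely in every `E' ⊆ E` (Marcus, Ch. 4, Cor. to Thm. 29). [folklore] -/
theorem splitPrimes_anti {E E' : IntermediateField M L} (hle : E' ≤ E)
    {q : HeightOneSpectrum (𝓞 M)} (hunr : Algebra.IsUnramifiedIn (𝓞 L) q.asIdeal)
    (hq : q ∈ splitPrimes M E) : q ∈ splitPrimes M E' := by
  rw [mem_splitPrimes_intermediateField_iff_forall _ hunr] at hq ⊢
  exact fun Q hQ φ hφ => IntermediateField.fixingSubgroup_le hle (hq Q hQ φ hφ)

/-- **Complete splitting ascends to composita**: if `q` (unramified in `L`) splits completely in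
`E` and in `E'` then it splits completely in `E E'` (Marcus, Ch. 4, Exercise 10 (c); Mathlib
`IntermediateField.fixingSubgroup_sup`). [folklore] -/
theorem mem_splitPrimes_sup {E E' : IntermediateField M L} {q : HeightOneSpectrum (𝓞 M)}
    (hunr : Algebra.IsUnramifiedIn (𝓞 L) q.asIdeal) (hq : q ∈ splitPrimes M E)
    (hq' : q ∈ splitPrimes M E') : q ∈ splitPrimes M (E ⊔ E' : IntermediateField M L) := by
  rw [mem_splitPrimes_intermediateField_iff_forall _ hunr] at hq hq' ⊢
  intro Q hQ φ hφ
  rw [IntermediateField.fixingSubgroup_sup]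
  exact ⟨hq Q hQ φ hφ, hq' Q hQ φ hφ⟩

/-- Every prime unramified in `L` splits completely in the ground field `M = ⊥`. [folklore] -/
theorem mem_splitPrimes_bot {q : HeightOneSpectrum (𝓞 M)}
    (hunr : Algebra.IsUnramifiedIn (𝓞 L) q.asIdeal) :
    q ∈ splitPrimes M (⊥ : IntermediateField M L) := by
  rw [mem_splitPrimes_intermediateField_iff_forall _ hunr]
  intro Q _ φ _
  rw [IntermediateField.fixingSubgroup_bot]
  exact Subgroup.mem_top φ

/-- **One Frobenius not fixing `E` obstructs complete splitting in `E`.** [folklore] -/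
theorem not_mem_splitPrimes_of_not_mem_fixingSubgroup {E : IntermediateField M L}
    {q : HeightOneSpectrum (𝓞 M)} (hunr : Algebra.IsUnramifiedIn (𝓞 L) q.asIdeal)
    {Q : Ideal (𝓞 L)} (hQ : Q ∈ q.asIdeal.primesOver (𝓞 L)) {φ : L ≃ₐ[M] L}
    (hφ : IsArithFrobAt (𝓞 M) φ Q) (hφE : φ ∉ E.fixingSubgroup) : q ∉ splitPrimes M E :=
  fun h => hφE ((mem_splitPrimes_intermediateField_iff_forall E hunr).mp h Q hQ φ hφ)

/-! ### §2. Disjointness from a field all of whose non-trivial subfields are detected by `V` -/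

/-- **Linear disjointness from splitting conditions** (ACC+ Thm. 6.1.1, proof, §6.5.12: "For each
proper subfield `K/K'/F`, there exists `v ∈ V₁` which does not split in `K'` … [then] `E ∩ K = F`"
for `V₁`-split `E`).  If every non-trivial subfield `M ⊊ K' ⊆ K` contains... more precisely fails
to be completely split at some prime of `V` (primes unramified in `L`), and every prime of `V`
splits completely in `E`, then `E ∩ K = M`: otherwise `K' = E ∩ K ⊆ E` would be completely split
at all of `V` (`splitPrimes_anti`). [cite: ACCGHLNSTT2023, §6.5.12 (choice of `V₁`)] -/
theorem inf_eq_bot_of_splitPrimes {K E : IntermediateField M L} {V : Set (HeightOneSpectrum (𝓞 M))}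
    (hVunr : ∀ q ∈ V, Algebra.IsUnramifiedIn (𝓞 L) q.asIdeal)
    (hV : ∀ K' : IntermediateField M L, K' ≤ K → K' ≠ ⊥ → ∃ q ∈ V, q ∉ splitPrimes M K')
    (hE : V ⊆ splitPrimes M E) : E ⊓ K = ⊥ := by
  by_contra hne
  obtain ⟨q, hqV, hq⟩ := hV (E ⊓ K) inf_le_right hne
  exact hq (splitPrimes_anti inf_le_left (hVunr q hqV) (hE hqV))

/-- **Relative disjointness** (ACC+, loc. cit., choice of `V₀`: "for each proper subfield
`K/K'/F(ζ_p)`, there exists `v ∈ V₀` such that `v` splits in `F(ζ_p)` but does not split in `K'`"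
gives `E(ζ_p) ∩ K = F(ζ_p)`).  If `F₁ ≤ K₁`, every subfield `F₁ ⊊ K' ⊆ K₁` fails to be completely
split at some `q ∈ V` which IS completely split in `F₁`, and every prime of `V` splits completely
in `E`, then `E F₁ ∩ K₁ = F₁` (`mem_splitPrimes_sup`, `splitPrimes_anti`).
[cite: ACCGHLNSTT2023, §6.5.12 (choice of `V₀`)] -/
theorem sup_inf_eq_of_splitPrimes {F₁ K₁ E : IntermediateField M L}
    {V : Set (HeightOneSpectrum (𝓞 M))} (hVunr : ∀ q ∈ V, Algebra.IsUnramifiedIn (𝓞 L) q.asIdeal)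
    (h₁ : F₁ ≤ K₁)
    (hV : ∀ K' : IntermediateField M L, F₁ ≤ K' → K' ≤ K₁ → K' ≠ F₁ →
      ∃ q ∈ V, q ∈ splitPrimes M F₁ ∧ q ∉ splitPrimes M K')
    (hE : V ⊆ splitPrimes M E) : (E ⊔ F₁) ⊓ K₁ = F₁ := by
  by_contra hne
  obtain ⟨q, hqV, hq₁, hq⟩ := hV ((E ⊔ F₁) ⊓ K₁) (le_inf le_sup_right h₁) inf_le_right hne
  exact hq (splitPrimes_anti inf_le_left (hVunr q hqV)
    (mem_splitPrimes_sup (hVunr q hqV) (hE hqV) hq₁))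

/-! ### §3. Existence of the detecting sets `V₁`, `V₀` (Bauer / Chebotarev) -/

/-- A non-trivial subextension is moved by some element of the Galois group. [folklore] -/
theorem exists_not_mem_fixingSubgroup {K' : IntermediateField M L} (hK' : K' ≠ ⊥) :
    ∃ g : L ≃ₐ[M] L, g ∉ K'.fixingSubgroup := by
  haveI : FiniteDimensional M L := Module.Finite.of_restrictScalars_finite ℚ M L
  by_contra! hall
  apply hK'
  have htop : K'.fixingSubgroup = ⊤ := eq_top_iff.mpr fun g _ => hall g
  have h := IsGalois.fixedField_fixingSubgroup K'
  rw [htop, IsGalois.fixedField_top] at h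
  exact h.symm

/-- Strict subextensions `F₁ < K'` are separated by the Galois group: some `g` fixes `F₁` but not
`K'`. [folklore] -/
theorem exists_mem_fixingSubgroup_not_mem {F₁ K' : IntermediateField M L} (hle : F₁ ≤ K')
    (hne : K' ≠ F₁) : ∃ g : L ≃ₐ[M] L, g ∈ F₁.fixingSubgroup ∧ g ∉ K'.fixingSubgroup := by
  haveI : FiniteDimensional M L := Module.Finite.of_restrictScalars_finite ℚ M L
  by_contra! hall
  apply hne
  have hle' : F₁.fixingSubgroup ≤ K'.fixingSubgroup := fun g hg => hall g hg
  have heq : K'.fixingSubgroup = F₁.fixingSubgroup :=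
    le_antisymm (IntermediateField.fixingSubgroup_le hle) hle'
  rw [← IsGalois.fixedField_fixingSubgroup K', heq, IsGalois.fixedField_fixingSubgroup]

/-- **Existence of `V₁`** (ACC+ Thm. 6.1.1, proof, §6.5.12: "For each proper subfield `K/K'/F`,
there exists `v ∈ V₁` which does not split in `K'`").  For a finite Galois `L/M` and any finite
set `S` of primes of `M` there is a finite set `V` of primes of `M` outside `S`, of prime absolute
norm and unramified in `L`, such that every non-trivial subextension `K' ≠ M` of `L/M` fails to be
completely split at some `q ∈ V`.  Proof: finitely many `K'` (primitive element theorem); for each,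
an element `g ∉ Gal(L/K')` and, by Bauer–Chebotarev (`infinite_setOf_exists_isArithFrobAt`), a
degree-one prime `q ∉ S` unramified in `L` at which `g` is a Frobenius.
[cite: ACCGHLNSTT2023, §6.5.12 (choice of `V₁`)] [cite: NeukirchANT1999, Ch. VII (13.4)] -/
theorem exists_finset_forall_not_mem_splitPrimes (S : Set (HeightOneSpectrum (𝓞 M)))
    (hS : S.Finite) :
    ∃ V : Finset (HeightOneSpectrum (𝓞 M)),
      (∀ q ∈ V, q ∉ S ∧ (Ideal.absNorm q.asIdeal).Prime ∧ Algebra.IsUnramifiedIn (𝓞 L) q.asIdeal) ∧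
      ∀ K' : IntermediateField M L, K' ≠ ⊥ → ∃ q ∈ V, q ∉ splitPrimes M K' := by
  -- finitely many intermediate fields (primitive element theorem)
  haveI : FiniteDimensional M L := Module.Finite.of_restrictScalars_finite ℚ M L
  haveI : Finite (IntermediateField M L) :=
    Field.finite_intermediateField_of_exists_primitive_element M L
      (Field.exists_primitive_element M L)
  haveI := Fintype.ofFinite (IntermediateField M L)
  -- for every `K'` a good prime, detecting `K'` when `K' ≠ ⊥`
  have key : ∀ K' : IntermediateField M L, ∃ q : HeightOneSpectrum (𝓞 M), q ∉ S ∧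
      (Ideal.absNorm q.asIdeal).Prime ∧ Algebra.IsUnramifiedIn (𝓞 L) q.asIdeal ∧
      (K' ≠ ⊥ → q ∉ splitPrimes M K') := by
    intro K'
    -- an element `g` to be realised as a Frobenius: outside `Gal(L/K')` if `K' ≠ ⊥`
    have hg : ∃ g : L ≃ₐ[M] L, K' ≠ ⊥ → g ∉ K'.fixingSubgroup := by
      by_cases hK' : K' = ⊥
      · exact ⟨1, fun h => absurd hK' h⟩
      · obtain ⟨g, hg⟩ := exists_not_mem_fixingSubgroup hK'
        exact ⟨g, fun _ => hg⟩
    obtain ⟨g, hg⟩ := hg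
    obtain ⟨q, ⟨hprime, hunr, Q, hQ, hφ⟩, hqS⟩ :=
      ((infinite_setOf_exists_isArithFrobAt (F := M) (L := L) g).sdiff hS).nonempty
    exact ⟨q, hqS, hprime, hunr, fun hK' =>
      not_mem_splitPrimes_of_not_mem_fixingSubgroup hunr hQ hφ (hg hK')⟩
  choose f hf using key
  refine ⟨Finset.univ.image f, fun q hq => ?_, fun K' hK' => ?_⟩
  · obtain ⟨K', -, rfl⟩ := Finset.mem_image.mp hq
    exact ⟨(hf K').1, (hf K').2.1, (hf K').2.2.1⟩
  · exact ⟨f K', Finset.mem_image_of_mem f (Finset.mem_univ _), (hf K').2.2.2 hK'⟩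

/-- **Existence of `V₀`** (ACC+ Thm. 6.1.1, proof, §6.5.12: "for each `v ∈ V₀`, `v` splits in
`F(ζ_p)`. For each proper subfield `K/K'/F(ζ_p)`, there exists `v ∈ V₀` such that `v` splits in
`F(ζ_p)` but does not split in `K'`").  For `F₁` an intermediate field of the finite Galois `L/M`
which is Galois over `M`, and any finite `S`, there is a finite set `V` of primes of `M` outside
`S`, of prime absolute norm, unramified in `L` and completely split in `F₁`, such that every
subextension `K'` with `F₁ ⊊ K'` fails to be completely split at some `q ∈ V`.  Proof: realise an
element of `Gal(L/F₁) ∖ Gal(L/K')` as a Frobenius at a degree-one prime (Bauer–Chebotarev); such a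
prime splits completely in the Galois `F₁` (`mem_splitPrimes_intermediateField_iff`) but not in
`K'`. [cite: ACCGHLNSTT2023, §6.5.12 (choice of `V₀`)] [cite: NeukirchANT1999, Ch. VII (13.4)] -/
theorem exists_finset_forall_not_mem_splitPrimes_of_le (F₁ : IntermediateField M L) [IsGalois M F₁]
    (S : Set (HeightOneSpectrum (𝓞 M))) (hS : S.Finite) :
    ∃ V : Finset (HeightOneSpectrum (𝓞 M)),
      (∀ q ∈ V, q ∉ S ∧ (Ideal.absNorm q.asIdeal).Prime ∧
        Algebra.IsUnramifiedIn (𝓞 L) q.asIdeal ∧ q ∈ splitPrimes M F₁) ∧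
      ∀ K' : IntermediateField M L, F₁ ≤ K' → K' ≠ F₁ → ∃ q ∈ V, q ∉ splitPrimes M K' := by
  haveI : FiniteDimensional M L := Module.Finite.of_restrictScalars_finite ℚ M L
  haveI : Finite (IntermediateField M L) :=
    Field.finite_intermediateField_of_exists_primitive_element M L
      (Field.exists_primitive_element M L)
  haveI := Fintype.ofFinite (IntermediateField M L)
  haveI : NumberField F₁ := NumberField.of_module_finite M F₁
  have key : ∀ K' : IntermediateField M L, ∃ q : HeightOneSpectrum (𝓞 M), q ∉ S ∧
      (Ideal.absNorm q.asIdeal).Prime ∧ Algebra.IsUnramifiedIn (𝓞 L) q.asIdeal ∧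
      q ∈ splitPrimes M F₁ ∧ (F₁ ≤ K' → K' ≠ F₁ → q ∉ splitPrimes M K') := by
    intro K'
    have hg : ∃ g : L ≃ₐ[M] L, g ∈ F₁.fixingSubgroup ∧ (F₁ ≤ K' → K' ≠ F₁ → g ∉ K'.fixingSubgroup) := by
      by_cases h : F₁ ≤ K' ∧ K' ≠ F₁
      · obtain ⟨g, hg₁, hg⟩ := exists_mem_fixingSubgroup_not_mem h.1 h.2
        exact ⟨g, hg₁, fun _ _ => hg⟩
      · exact ⟨1, one_mem _, fun h1 h2 => absurd ⟨h1, h2⟩ h⟩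
    obtain ⟨g, hg₁, hg⟩ := hg
    obtain ⟨q, ⟨hprime, hunr, Q, hQ, hφ⟩, hqS⟩ :=
      ((infinite_setOf_exists_isArithFrobAt (F := M) (L := L) g).sdiff hS).nonempty
    have hsplit : q ∈ splitPrimes M F₁ :=
      (mem_splitPrimes_intermediateField_iff F₁ hunr
        (ArtinLemma.isUnramifiedIn_intermediateField F₁ hunr) hQ hφ).mpr hg₁
    exact ⟨q, hqS, hprime, hunr, hsplit, fun h1 h2 =>
      not_mem_splitPrimes_of_not_mem_fixingSubgroup hunr hQ hφ (hg h1 h2)⟩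
  choose f hf using key
  refine ⟨Finset.univ.image f, fun q hq => ?_, fun K' h1 h2 => ?_⟩
  · obtain ⟨K', -, rfl⟩ := Finset.mem_image.mp hq
    exact ⟨(hf K').1, (hf K').2.1, (hf K').2.2.1, (hf K').2.2.2.1⟩
  · exact ⟨f K', Finset.mem_image_of_mem f (Finset.mem_univ _), (hf K').2.2.2.2 h1 h2⟩

/-! ### §4. Images of Galois groups -/

/-- **`E ∩ L^{ker τ} = M ⟹ τ(Gal(L/E)) = τ(Gal(L/M))`** (Galois correspondence: the fixed field
of `Gal(L/E) · ker τ` lies in `E` and in `L^{ker τ}`, hence is `M`, so `Gal(L/E) · ker τ = Gal(L/M)`).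
This is "`ρ̄(G_E) = ρ̄(G_F)`" of ACC+ (loc. cit.) at finite level, `τ` the factorisation of `ρ̄`
through `Gal(L/F)`. [cite: ACCGHLNSTT2023, §6.5.12] -/
theorem map_fixingSubgroup_eq_range_of_inf_eq_bot {H : Type*} [Group H] (τ : (L ≃ₐ[M] L) →* H)
    {E : IntermediateField M L} (h : E ⊓ IntermediateField.fixedField τ.ker = ⊥) :
    E.fixingSubgroup.map τ = τ.range := by
  haveI : FiniteDimensional M L := Module.Finite.of_restrictScalars_finite ℚ M L
  -- `Gal(L/E) ⊔ ker τ = ⊤`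
  set H' : Subgroup (L ≃ₐ[M] L) := E.fixingSubgroup ⊔ τ.ker with hH'
  have hfix : IntermediateField.fixedField H' = ⊥ := by
    refine le_bot_iff.mp (h ▸ le_inf ?_ ?_)
    · calc IntermediateField.fixedField H' ≤ IntermediateField.fixedField E.fixingSubgroup :=
            IntermediateField.fixedField_le le_sup_left
        _ = E := IsGalois.fixedField_fixingSubgroup E
    · exact IntermediateField.fixedField_le le_sup_right
  have htop : H' = ⊤ := by
    rw [← IntermediateField.fixingSubgroup_fixedField H', hfix, IntermediateField.fixingSubgroup_bot]
  -- images
  refine le_antisymm (Subgroup.map_le_range τ _) fun x hx => ?_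
  obtain ⟨γ, rfl⟩ := MonoidHom.mem_range.mp hx
  have hγ : γ ∈ ((E.fixingSubgroup ⊔ τ.ker : Subgroup (L ≃ₐ[M] L)) : Set (L ≃ₐ[M] L)) := by
    rw [← hH', htop]
    exact Subgroup.mem_top γ
  rw [Subgroup.mul_normal] at hγ
  obtain ⟨e, he, k, hk, rfl⟩ := Set.mem_mul.mp hγ
  refine Subgroup.mem_map.mpr ⟨e, he, ?_⟩
  rw [map_mul, (MonoidHom.mem_ker).mp hk, mul_one]

/-- **`E F₁ ∩ L^{ker τ ∩ Gal(L/F₁)} = F₁ ⟹ τ(Gal(L/E) ∩ Gal(L/F₁)) = τ(Gal(L/F₁))`** for `F₁`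
Galois over `M` (so that `ker τ ∩ Gal(L/F₁)` is normal).  This is
"`ρ̄(G_{E(ζ_p)}) = ρ̄(G_{F(ζ_p)})`" of ACC+ (loc. cit.) at finite level, with `F₁ = F(ζ_p)`.
[cite: ACCGHLNSTT2023, §6.5.12] -/
theorem map_fixingSubgroup_inf_eq_of_sup_inf_eq {H : Type*} [Group H] (τ : (L ≃ₐ[M] L) →* H)
    {F₁ E : IntermediateField M L} [IsGalois M F₁]
    (h : (E ⊔ F₁) ⊓ IntermediateField.fixedField (τ.ker ⊓ F₁.fixingSubgroup) = F₁) :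
    (E.fixingSubgroup ⊓ F₁.fixingSubgroup).map τ = F₁.fixingSubgroup.map τ := by
  haveI : FiniteDimensional M L := Module.Finite.of_restrictScalars_finite ℚ M L
  set C : Subgroup (L ≃ₐ[M] L) := F₁.fixingSubgroup with hC
  set N : Subgroup (L ≃ₐ[M] L) := τ.ker ⊓ C with hN
  haveI : C.Normal := by rw [hC]; infer_instance
  haveI : N.Normal := by rw [hN]; infer_instance
  have hEF : (E ⊔ F₁).fixingSubgroup = E.fixingSubgroup ⊓ C := IntermediateField.fixingSubgroup_sup
  -- `Gal(L/E F₁) ⊔ N = C`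
  set H' : Subgroup (L ≃ₐ[M] L) := (E ⊔ F₁).fixingSubgroup ⊔ N with hH'
  have hle : H' ≤ C := sup_le (hEF ▸ inf_le_right) inf_le_right
  have hfix : IntermediateField.fixedField H' ≤ F₁ := by
    refine h ▸ le_inf ?_ ?_
    · calc IntermediateField.fixedField H' ≤ IntermediateField.fixedField (E ⊔ F₁).fixingSubgroup :=
            IntermediateField.fixedField_le le_sup_left
        _ = E ⊔ F₁ := IsGalois.fixedField_fixingSubgroup (E ⊔ F₁)
    · exact IntermediateField.fixedField_le le_sup_right
  have hge : C ≤ H' := by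
    have h1 : F₁.fixingSubgroup ≤ (IntermediateField.fixedField H').fixingSubgroup :=
      IntermediateField.fixingSubgroup_le hfix
    rwa [IntermediateField.fixingSubgroup_fixedField H'] at h1
  have hH'C : H' = C := le_antisymm hle hge
  -- images
  refine le_antisymm (Subgroup.map_mono inf_le_right) fun x hx => ?_
  obtain ⟨c, hc, rfl⟩ := Subgroup.mem_map.mp hx
  have hc' : c ∈ (((E ⊔ F₁).fixingSubgroup ⊔ N : Subgroup (L ≃ₐ[M] L)) : Set (L ≃ₐ[M] L)) := by
    rw [← hH', hH'C]
    exact hc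
  rw [Subgroup.mul_normal] at hc'
  obtain ⟨e, he, k, hk, rfl⟩ := Set.mem_mul.mp hc'
  refine Subgroup.mem_map.mpr ⟨e, hEF ▸ he, ?_⟩
  rw [map_mul, (MonoidHom.mem_ker).mp (hk.1), mul_one]

/-! ### §5. The printed statement -/

/-- **A `V`-split extension does not change the image of `τ`, nor its image on `Gal(·/F₁)`**
(ACC+ Thm. 6.1.1, proof, §6.5.12: "If `E/F` is any finite Galois extension which is
`V₀ ∪ V₁ ∪ V₂`-split, then … `ρ̄(G_E) = ρ̄(G_F)` and `ρ̄(G_{E(ζ_p)}) = ρ̄(G_{F(ζ_p)})`"), at finite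
level.  Let `L/M` be a finite Galois extension of number fields, `τ : Gal(L/M) → H` a
homomorphism, `F₁` an intermediate field Galois over `M`, and `S` a finite set of primes of `M`.
There is a finite set `V` of primes of `M` outside `S`, of prime absolute norm (degree one) and
unramified in `L`, such that for EVERY subextension `E` of `L/M` in which all primes of `V` split
completely: `τ(Gal(L/E)) = τ(Gal(L/M))` and `τ(Gal(L/E) ∩ Gal(L/F₁)) = τ(Gal(L/F₁))`.  (`V` is the
union of the sets `V₁`, `V₀` of §3 for `K = L^{ker τ}` and `K₁ = L^{ker τ ∩ Gal(L/F₁)}`, and §§2, 4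
conclude.)  Galoisness of `E/M` is not needed. [cite: ACCGHLNSTT2023, §6.5.12 (`V₀ ∪ V₁`-split
extensions)] -/
theorem exists_finset_map_fixingSubgroup_eq_of_splitPrimes {H : Type*} [Group H]
    (τ : (L ≃ₐ[M] L) →* H) (F₁ : IntermediateField M L) [IsGalois M F₁]
    (S : Set (HeightOneSpectrum (𝓞 M))) (hS : S.Finite) :
    ∃ V : Finset (HeightOneSpectrum (𝓞 M)),
      (∀ q ∈ V, q ∉ S ∧ (Ideal.absNorm q.asIdeal).Prime ∧ Algebra.IsUnramifiedIn (𝓞 L) q.asIdeal) ∧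
      ∀ E : IntermediateField M L, (∀ q ∈ V, q ∈ splitPrimes M E) →
        E.fixingSubgroup.map τ = τ.range ∧
        (E.fixingSubgroup ⊓ F₁.fixingSubgroup).map τ = F₁.fixingSubgroup.map τ := by
  haveI : FiniteDimensional M L := Module.Finite.of_restrictScalars_finite ℚ M L
  obtain ⟨V₁, hV₁, hV₁'⟩ := exists_finset_forall_not_mem_splitPrimes (M := M) (L := L) S hS
  obtain ⟨V₀, hV₀, hV₀'⟩ := exists_finset_forall_not_mem_splitPrimes_of_le (M := M) (L := L) F₁ S hS
  refine ⟨V₁ ∪ V₀, fun q hq => ?_, fun E hE => ⟨?_, ?_⟩⟩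
  · rcases Finset.mem_union.mp hq with h | h
    · exact hV₁ q h
    · exact ⟨(hV₀ q h).1, (hV₀ q h).2.1, (hV₀ q h).2.2.1⟩
  · refine map_fixingSubgroup_eq_range_of_inf_eq_bot τ
      (inf_eq_bot_of_splitPrimes (V := (↑V₁ : Set (HeightOneSpectrum (𝓞 M))))
        (fun q hq => (hV₁ q hq).2.2) (fun K' _ hK' => hV₁' K' hK') fun q hq => hE q ?_)
    exact Finset.mem_union_left _ hq
  · refine map_fixingSubgroup_inf_eq_of_sup_inf_eq τ
      (sup_inf_eq_of_splitPrimes (V := (↑V₀ : Set (HeightOneSpectrum (𝓞 M))))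
        (fun q hq => (hV₀ q hq).2.2.1) ?_ (fun K' h1 _ h2 => ?_) fun q hq => hE q ?_)
    · -- `F₁ ≤ L^{ker τ ∩ Gal(L/F₁)}`
      rw [IntermediateField.le_iff_le]
      exact inf_le_right
    · obtain ⟨q, hq, hq'⟩ := hV₀' K' h1 h2
      exact ⟨q, hq, (hV₀ q hq).2.2.2, hq'⟩
    · exact Finset.mem_union_right _ hq

end Literature.NumberTheory.NumberFields

end
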